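import Literature.AlgebraicGeometry.HodgeTheory.HomComplexSigma
import Literature.AlgebraicGeometry.HodgeTheory.HomComplexSingleColumn
import Literature.AlgebraicGeometry.HodgeTheory.DerivedDescentCommShift
import Literature.AlgebraicGeometry.HodgeTheory.SigmaArgument
import Literature.AlgebraicGeometry.Modules.ExtCohomologyComparison
import HarnessLib

/-!
# The complex-level semiregularity map on a single complex `E₀[0]` IS the module-level one

PROMOTED LITERATURE COPY (librarian protocol (b); DEFREQ-CoherentISemiregular, cell pub-hsemireg) of the generic, conjecture-free
`Summits/Ventures/HSemireg/HomComplexSigmaSingle.lean` — namespace now `Literature.AlgebraicGeometry.HodgeTheory`, names kept; cell words (seats, ventures) = provenance.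

Cell `pub-hsemireg`, general-structure seat gs-g4 (K2-MIN anchor assembly, steps (A2)(ii)+(A3)+(A4) + assembly of p3's
K2-ANCHOR-PLAN; (A1) = `SigmaArgument.lean`, (A2)(i) = p3's `DerivedDescentCommShift.lean`, the carriers = t-7's
`HomComplexSigma.lean`). HONEST FRAMING: infrastructure on the tree's REAL carriers only — NOT a door, NOT a named fact,
NOT a statement about any variety, NOT a «K2 result»; nothing here says HC, HC_CM or HC_AV is proved.

CONTENTS (all proved; Mathlib + tree only). For an `S`-scheme `X`, a finite locally free module `E₀` and the single
complex `E₀[0]` (strictly perfect, amplitude `[0, 0]`):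
* **`HomComplex.supertrace_single₀`** ((A4)) — t-7/p3's supertrace `Tr• : 𝓗om•(E₀[0], E₀[0] ⊗ G) ⟶ G[0]`, read through
  the column isomorphism `𝓗om•(E₀[0], F•) ≅ 𝓗om(E₀, F•)` and the single-complex identifications, is the single-complex
  map of the module contraction `contract : 𝓗om(E₀, 𝓗om(E₀^∨, G)) ⟶ G`;
* **`shiftedHomMap_comp_mk₀`** ((F1a), generic) — the action `shiftedHomMap` of a descended endofunctor on shifted Homs
  commutes with post-composition by a degree-`0` class `Q.map g`: `Φ_*(x · g) = Φ_*(x) · Q(Φ g)`;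
* **`HomComplex.sigmaExt_single`** (the ANCHOR) — for `x ∈ Ext²(E₀, E₀)`:
  `sigmaExt X (E₀[0]) 0 0 hK q x.hom = traceExtCoeff hE₀ Ω^q (q+2) ((x · ι_{E₀}) · At(E₀)^q)`, i.e. t-7's `σ_q^C` of the
  single complex, evaluated on the image of a module class, is LITERALLY the argument-trace defining the module-level
  higher semiregularity map (`sigmaHigher_apply`, `HodgeTheory/SemiregularityHigherSigma.lean`). Assembly:
  (A1) `extMulAtiyahPower_single`; (F1a); (A2) the comparison `derivedLift 𝓗om•(E₀[0], –) ≅ 𝓗om(E₀, –)^D`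
  (`derivedLiftIsoMapDerivedCategory` along `columnNatIso`) commutes with shifts (p3's
  `natTrans_commShift_derivedLiftIsoMapDerivedCategory_hom` + gs-g4's `columnNatIso_commShift`), so `ShiftedHom.map`
  transports along it (Mathlib `ShiftedHom.map_naturality_2`); Mathlib's
  `mapDerivedCategoryFactors_…_mapDerivedCategorySingleFunctor_…` triangles; prefix = (A3) `unit_single₀`, suffix = (A4) +
  `columnIso_hom_naturality` + `twistHodgeIsoG = Iso.refl`. The `↑(q+2)` / `↑q + 2` and `Q (M[0])` / `singleFunctor`
  seams are crossed with `set_option backward.isDefEq.respectTransparency false` (statement-neutral).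

## References
* R.-O. Buchweitz, H. Flenner, *A semiregularity map for modules and applications to deformations*, Compositio
  Math. 137 (2003), Def. 4.1 / §4 (σ via `At^k` and the trace). [BuchweitzFlenner2003]
* L. Illusie, *Complexe cotangent et déformations I*, LNM 239 (1971), V.3–V.5 (Atiyah class and trace for perfect
  complexes). [Illusie1971]
-/

noncomputable section

open CategoryTheory CategoryTheory.Limits AlgebraicGeometry Opposite

namespace Literature.AlgebraicGeometry.HodgeTheory

open Literature.AlgebraicGeometry.Modules Literature.AlgebraicGeometry.Motives
open Literature.AlgebraicGeometry.HodgeTheory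

namespace HomComplex

section SupertraceSingle

universe w

variable (X : Scheme.{w}) (G : X.Modules) (E₀ : X.Modules) (hE₀ : IsFiniteLocallyFree E₀)
  (hK : ∀ n, IsFiniteLocallyFree ((single₀ X E₀).X n))

/-- **(A4)** The supertrace `Tr• : 𝓗om•(E₀[0], E₀[0] ⊗ G) ⟶ G[0]`, read through the column isomorphism and the
single-complex identifications `E₀[0] ⊗ G ≅ (E₀ ⊗ G)[0]`, `𝓗om(E₀, –) ∘ (M[0]) ≅ 𝓗om(E₀, M)[0]`, is the single-complex map of
the module contraction `contract : 𝓗om(E₀, 𝓗om(E₀^∨, G)) ⟶ G`. [cite: BuchweitzFlenner2003, Def. 4.1] -/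
theorem supertrace_single₀ :
    supertrace X G (single₀ X E₀) hK =
      (columnIso X E₀ (twistG X G (single₀ X E₀))).hom ≫
        ((sheafHomFunctor E₀).mapHomologicalComplex (ComplexShape.up ℤ)).map
          ((HomologicalComplex.singleMapHomologicalComplex (twistFunctor X G) (ComplexShape.up ℤ) 0).hom.app E₀) ≫
        (HomologicalComplex.singleMapHomologicalComplex (sheafHomFunctor E₀) (ComplexShape.up ℤ) 0).hom.app
          (sheafHom (dual E₀) G) ≫
        (HomologicalComplex.single X.Modules (ComplexShape.up ℤ) 0).map (contract hE₀ G) := by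
  refine HomologicalComplex.to_single_hom_ext ?_
  rw [supertrace, HomologicalComplex.mkHomToSingle_f, HomologicalComplex.comp_f, HomologicalComplex.comp_f,
    HomologicalComplex.comp_f, Functor.mapHomologicalComplex_map_f, HomologicalComplex.single_map_f_self,
    HomologicalComplex.singleMapHomologicalComplex_hom_app_self, HomologicalComplex.singleMapHomologicalComplex_hom_app_self]
  -- an equation of maps out of `𝓗om•(E₀[0], E₀[0] ⊗ G)^0`: check it on each summand `(q, i)`, `q + i = 0`
  refine HomologicalComplex.mapBifunctor.hom_ext fun q i hqi => ?_
  change ι X (single₀ X E₀) _ q i 0 hqi ≫ _ = ι X (single₀ X E₀) _ q i 0 hqi ≫ _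
  by_cases hi : i = 0
  · subst hi
    obtain rfl : q = 0 := by simpa using hqi
    rw [reassoc_of% (ι_str₀ X G (single₀ X E₀) hK 0 0 hqi), strComp, Int.negOnePow_zero, one_smul]
    erw [reassoc_of% (ι_columnHom_zero X E₀ (twistG X G (single₀ X E₀)) 0)]
    -- every transport isomorphism here is an `eqToHom` between definitionally equal objects
    erw [sheafHomMap_id, Category.id_comp]
    erw [Category.comp_id]
  · exact (isZero_sheafHom_of_isZero (isZero_single₀_X X E₀ i hi) _).eq_of_src _ _

end SupertraceSingle

section SigmaSingle

universe w₁ u₁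

variable {S : Type u₁} [CommRing S] (X : Over (Spec (CommRingCat.of S))) [HasDerivedCategory.{w₁} X.left.Modules]
  (E₀ : X.left.Modules) (hE₀ : IsFiniteLocallyFree E₀) (hK : ∀ p, IsFiniteLocallyFree ((single₀ X.left E₀).X p))

set_option backward.isDefEq.respectTransparency false in
omit [HasDerivedCategory X.left.Modules] in
/-- **(F1a)** The action `shiftedHomMap` of a descended endofunctor `Φ` on shifted Homs commutes with post-composition
by a degree-`0` class: `Φ_*(x · Q(g)) = Φ_*(x) · Q(Φ g)` (naturality of the factorisation `Q ⋙ derivedLift Φ ≅ Φ ⋙ Q`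
and of the `CommShift` isomorphism). [cite: BuchweitzFlenner2003, Def. 4.1] -/
theorem _root_.Literature.AlgebraicGeometry.HodgeTheory.shiftedHomMap_comp_mk₀ {C : Type*} [Category C] [Abelian C] [HasDerivedCategory C]
    (Φ : CochainComplex C ℤ ⥤ CochainComplex C ℤ) [Φ.CommShift ℤ]
    (hΦ : (HomologicalComplex.quasiIso C (ComplexShape.up ℤ)).IsInvertedBy (Φ ⋙ DerivedCategory.Q))
    {A B B' : CochainComplex C ℤ} {n : ℤ} (y : ShiftedHom (DerivedCategory.Q.obj A) (DerivedCategory.Q.obj B) n)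
    (g : B ⟶ B') :
    shiftedHomMap Φ hΦ (y.comp (ShiftedHom.mk₀ (0 : ℤ) rfl (DerivedCategory.Q.map g)) (zero_add n)) =
      (shiftedHomMap Φ hΦ y).comp (ShiftedHom.mk₀ (0 : ℤ) rfl (DerivedCategory.Q.map (Φ.map g))) (zero_add n) := by
  have hnat : (derivedLift Φ hΦ).map (DerivedCategory.Q.map g) ≫ (derivedLiftFac Φ hΦ).hom.app B' =
      (derivedLiftFac Φ hΦ).hom.app B ≫ DerivedCategory.Q.map (Φ.map g) := (derivedLiftFac Φ hΦ).hom.naturality g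
  simp only [shiftedHomMap, ShiftedHom.comp_mk₀, ShiftedHom.map, Functor.map_comp]
  simp only [Category.assoc]
  rw [Functor.commShiftIso_hom_naturality_assoc, ← Functor.map_comp, ← Functor.map_comp, hnat]

/-! ### The anchor -/

set_option backward.isDefEq.respectTransparency false in
/-- **ANCHOR** `σ_q^C(E₀[0]) = σ_q(E₀)`: for a finite locally free module `E₀` and `x ∈ Ext²(E₀, E₀)`, t-7's
complex-level semiregularity map of the single complex `E₀[0]` at the derived-category image `x.hom` of `x` equals the
argument-trace `traceExtCoeff hE₀ Ω^q (q+2) ((x · ι_{E₀}) · At(E₀)^q)` — literally the right-hand side of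
`sigmaHigher_apply` (so `σ_q^C(E₀[0])(x.hom) = sigmaHigher hE₀ q x`). [cite: BuchweitzFlenner2003, Def. 4.1] -/
theorem sigmaExt_single (q : ℕ) (x : Abelian.Ext E₀ E₀ 2) :
    sigmaExt X (single₀ X.left E₀) 0 0 hK q x.hom =
      traceExtCoeff hE₀ (hodgeSheaf X q) (q + 2)
        ((x.comp (Abelian.Ext.mk₀ (toTwistHodgeZero E₀)) (add_zero 2)).comp (atiyahClassPower E₀ q) (add_comm 2 q)) := by
  letI := preservesFiniteColimits_sheafHomFunctor E₀ hE₀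
  rw [sigmaExt, Equiv.symm_apply_eq]
  change sigmaC X (single₀ X.left E₀) 0 0 hK q x.hom = Abelian.Ext.hom _
  rw [traceExtCoeff_apply, Abelian.Ext.comp_hom, Abelian.Ext.comp_hom, Abelian.Ext.mk₀_hom, Abelian.Ext.mk₀_hom,
    Abelian.Ext.mapExactFunctor_hom]
  rw [ShiftedHom.mk₀_comp, ShiftedHom.comp_mk₀]
  -- LHS
  rw [sigmaC, phiMulAtiyahPower, unitQ, supertraceH]
  -- (A1): the argument of σ_q at E₀[0] is the module class `w`
  have hA1 := extMulAtiyahPower_single (X := X) q E₀ x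
  have hext : extMulAtiyahPower X ((HomologicalComplex.single X.left.Modules (ComplexShape.up ℤ) 0).obj E₀) q x.hom =
      (((x.comp (Abelian.Ext.mk₀ (toTwistHodgeZero E₀)) (add_zero 2)).comp (atiyahClassPower E₀ q) (add_comm 2 q)).hom).comp
        (ShiftedHom.mk₀ (0 : ℤ) rfl (DerivedCategory.Q.map (twistHodgeComplexSingleIso q E₀).inv)) (zero_add _) := by
    rw [← hA1, shiftedHom_comp_comp_mk₀, ShiftedHom.mk₀_comp_mk₀, ← Functor.map_comp, Iso.hom_inv_id,
      CategoryTheory.Functor.map_id]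
    erw [ShiftedHom.comp_mk₀_id]
  rw [hext, Literature.AlgebraicGeometry.HodgeTheory.shiftedHomMap_comp_mk₀]
  set w := (x.comp (Abelian.Ext.mk₀ (toTwistHodgeZero E₀)) (add_zero 2)).comp (atiyahClassPower E₀ q) (add_comm 2 q) with hw
  haveI : NatTrans.CommShift (derivedLiftIsoMapDerivedCategory (homFunctor X.left (single₀ X.left E₀)) (homFunctor_isInvertedBy X (single₀ X.left E₀) 0 0 hK) (sheafHomFunctor E₀) (columnNatIso X.left E₀)).hom ℤ := natTrans_commShift_derivedLiftIsoMapDerivedCategory_hom _ _ _ _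
  -- (A2): Φ' acts on w.hom as G.mapDerivedCategory does, up to e
  have hmap : w.hom.map (derivedLift (homFunctor X.left (single₀ X.left E₀)) (homFunctor_isInvertedBy X (single₀ X.left E₀) 0 0 hK)) =
      (ShiftedHom.mk₀ (0 : ℤ) rfl ((derivedLiftIsoMapDerivedCategory (homFunctor X.left (single₀ X.left E₀)) (homFunctor_isInvertedBy X (single₀ X.left E₀) 0 0 hK) (sheafHomFunctor E₀) (columnNatIso X.left E₀)).hom.app _)).comp
        ((w.hom.map (sheafHomFunctor E₀).mapDerivedCategory).comp (ShiftedHom.mk₀ (0 : ℤ) rfl ((derivedLiftIsoMapDerivedCategory (homFunctor X.left (single₀ X.left E₀)) (homFunctor_isInvertedBy X (single₀ X.left E₀) 0 0 hK) (sheafHomFunctor E₀) (columnNatIso X.left E₀)).inv.app _)) (zero_add _))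
        (add_zero _) :=
    (ShiftedHom.map_naturality_2 w.hom (derivedLiftIsoMapDerivedCategory (homFunctor X.left (single₀ X.left E₀)) (homFunctor_isInvertedBy X (single₀ X.left E₀) 0 0 hK) (sheafHomFunctor E₀) (columnNatIso X.left E₀))).symm
  rw [shiftedHomMap, hmap]
  simp only [ShiftedHom.mk₀_comp, ShiftedHom.comp_mk₀, Category.assoc, Functor.map_comp]
  -- the comparison iso `e` on objects of the form `Q K`: Localization.liftNatTrans_app
  have he_hom : (derivedLiftIsoMapDerivedCategory (homFunctor X.left (single₀ X.left E₀)) (homFunctor_isInvertedBy X (single₀ X.left E₀) 0 0 hK) (sheafHomFunctor E₀) (columnNatIso X.left E₀)).hom.app ((DerivedCategory.singleFunctor X.left.Modules 0).obj E₀) =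
      (derivedLiftFac (homFunctor X.left (single₀ X.left E₀)) (homFunctor_isInvertedBy X (single₀ X.left E₀) 0 0 hK)).hom.app (single₀ X.left E₀) ≫
        DerivedCategory.Q.map (columnIso X.left E₀ (single₀ X.left E₀)).hom ≫
          (sheafHomFunctor E₀).mapDerivedCategoryFactors.inv.app (single₀ X.left E₀) := by
    rw [derivedLiftIsoMapDerivedCategory, Localization.liftNatIso_hom]
    erw [Localization.liftNatTrans_app]
    rfl
  have he_inv : (derivedLiftIsoMapDerivedCategory (homFunctor X.left (single₀ X.left E₀)) (homFunctor_isInvertedBy X (single₀ X.left E₀) 0 0 hK) (sheafHomFunctor E₀) (columnNatIso X.left E₀)).inv.app ((DerivedCategory.singleFunctor X.left.Modules 0).obj (twistHodge E₀ q)) =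
      (sheafHomFunctor E₀).mapDerivedCategoryFactors.hom.app (single₀ X.left (twistHodge E₀ q)) ≫
        DerivedCategory.Q.map (columnIso X.left E₀ (single₀ X.left (twistHodge E₀ q))).inv ≫
          (derivedLiftFac (homFunctor X.left (single₀ X.left E₀)) (homFunctor_isInvertedBy X (single₀ X.left E₀) 0 0 hK)).inv.app (single₀ X.left (twistHodge E₀ q)) := by
    rw [derivedLiftIsoMapDerivedCategory, Localization.liftNatIso_inv]
    erw [Localization.liftNatTrans_app]
    rfl
  rw [he_hom, he_inv]
  simp only [Category.assoc, Functor.map_comp, Iso.inv_hom_id_app_assoc]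
  -- cancel `fac⁻¹ ≫ fac` across the degree seam `↑(q+2) = ↑q + 2` (definitional) and the two spellings of `(E₀ ⊗ Ω^q)[0]`
  erw [← Functor.map_comp_assoc (shiftFunctor (DerivedCategory X.left.Modules) ((q : ℤ) + 2))
    ((derivedLiftFac (homFunctor X.left (single₀ X.left E₀)) (homFunctor_isInvertedBy X (single₀ X.left E₀) 0 0 hK)).inv.app
      (single₀ X.left (twistHodge E₀ q)))
    ((derivedLiftFac (homFunctor X.left (single₀ X.left E₀)) (homFunctor_isInvertedBy X (single₀ X.left E₀) 0 0 hK)).hom.app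
      (single₀ X.left (twistHodge E₀ q)))]
  erw [Iso.inv_hom_id_app, CategoryTheory.Functor.map_id, Category.id_comp]
  -- RHS: Mathlib's single-functor comparison isos in terms of `mapDerivedCategoryFactors` and `Q (singleMap…)`
  have hAinv : ((sheafHomFunctor E₀).mapDerivedCategorySingleFunctor 0).inv.app E₀ =
      DerivedCategory.Q.map (((sheafHomFunctor E₀).mapCochainComplexSingleFunctor 0).inv.app E₀) ≫
        (sheafHomFunctor E₀).mapDerivedCategoryFactors.inv.app (single₀ X.left E₀) := by
    rw [← Functor.mapDerivedCategorySingleFunctor_inv_app_mapDerivedCategoryFactors_hom_app, Category.assoc,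
      Iso.hom_inv_id_app]
    erw [Category.comp_id]
  have hAhom : ((sheafHomFunctor E₀).mapDerivedCategorySingleFunctor 0).hom.app (sheafHom (dual E₀) (hodgeSheaf X q)) =
      (sheafHomFunctor E₀).mapDerivedCategoryFactors.hom.app (single₀ X.left (twistHodge E₀ q)) ≫
        DerivedCategory.Q.map (((sheafHomFunctor E₀).mapCochainComplexSingleFunctor 0).hom.app (twistHodge E₀ q)) := by
    rw [← Functor.mapDerivedCategoryFactors_inv_app_mapDerivedCategorySingleFunctor_hom_app, Iso.hom_inv_id_app_assoc]
  rw [hAinv, hAhom]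
  simp only [Category.assoc, Functor.map_comp]
  -- prefix: (A3)
  have hpre : unit X.left (single₀ X.left E₀) 0 0 ≫ (columnIso X.left E₀ (single₀ X.left E₀)).hom =
      (HomologicalComplex.single X.left.Modules (ComplexShape.up ℤ) 0).map (sheafHomUnit E₀) ≫
        ((sheafHomFunctor E₀).mapCochainComplexSingleFunctor 0).inv.app E₀ := by
    rw [← cancel_mono (((sheafHomFunctor E₀).mapCochainComplexSingleFunctor 0).hom.app E₀), Category.assoc,
      Category.assoc, Iso.inv_hom_id_app]
    erw [Category.comp_id]
    exact unit_single₀ X.left E₀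
  -- suffix: (A4) + naturality of the column isomorphism + `twistHodgeIsoG = Iso.refl`
  have hsuf : (homFunctor X.left (single₀ X.left E₀)).map (twistHodgeComplexSingleIso q E₀).inv ≫
      (homFunctor X.left (single₀ X.left E₀)).map (twistHodgeIsoG X (single₀ X.left E₀) q).hom ≫
      supertrace X.left (hodgeSheaf X q) (single₀ X.left E₀) hK =
      (columnIso X.left E₀ (single₀ X.left (twistHodge E₀ q))).hom ≫
      ((sheafHomFunctor E₀).mapCochainComplexSingleFunctor 0).hom.app (twistHodge E₀ q) ≫
        (HomologicalComplex.single X.left.Modules (ComplexShape.up ℤ) 0).map (contract hE₀ (hodgeSheaf X q)) := by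
    rw [supertrace_single₀ X.left (hodgeSheaf X q) E₀ hE₀ hK]
    erw [show (twistHodgeIsoG X (single₀ X.left E₀) q).hom = 𝟙 _ from rfl, CategoryTheory.Functor.map_id,
      Category.id_comp]
    have hnat : (homFunctor X.left (single₀ X.left E₀)).map (twistHodgeComplexSingleIso q E₀).inv ≫
        (columnIso X.left E₀ (twistG X.left (hodgeSheaf X q) (single₀ X.left E₀))).hom =
        (columnIso X.left E₀ (single₀ X.left (twistHodge E₀ q))).hom ≫
          ((sheafHomFunctor E₀).mapHomologicalComplex (ComplexShape.up ℤ)).map (twistHodgeComplexSingleIso q E₀).inv :=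
      columnIso_hom_naturality X.left E₀ (F' := twistG X.left (hodgeSheaf X q) (single₀ X.left E₀))
        (twistHodgeComplexSingleIso q E₀).inv
    have hσ : (twistHodgeComplexSingleIso q E₀).inv ≫
        (HomologicalComplex.singleMapHomologicalComplex (twistFunctor X.left (hodgeSheaf X q))
          (ComplexShape.up ℤ) 0).hom.app E₀ = 𝟙 _ :=
      (twistHodgeComplexSingleIso q E₀).inv_hom_id
    rw [reassoc_of% hnat, ← Functor.map_comp_assoc, hσ, CategoryTheory.Functor.map_id, Category.id_comp]
    rfl
  -- the two column isomorphisms in the middle cancel (across the `↑(q+2)` / `↑q + 2` seam)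
  have hT1 : (shiftFunctor (DerivedCategory X.left.Modules) ((q + 2 : ℕ) : ℤ)).map
        (DerivedCategory.Q.map (columnIso X.left E₀ (single₀ X.left (twistHodge E₀ q))).inv) ≫
      (shiftFunctor (DerivedCategory X.left.Modules) ((q : ℤ) + 2)).map
        (DerivedCategory.Q.map (columnIso X.left E₀ (single₀ X.left (twistHodge E₀ q))).hom) = 𝟙 _ := by
    change (shiftFunctor (DerivedCategory X.left.Modules) ((q : ℤ) + 2)).map _ ≫ _ = _
    rw [← Functor.map_comp, ← Functor.map_comp, Iso.inv_hom_id, CategoryTheory.Functor.map_id,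
      CategoryTheory.Functor.map_id]
    all_goals rfl
  rw [← Functor.map_comp_assoc, hpre, Functor.map_comp_assoc]
  have hsufQ := congrArg (fun φ => (shiftFunctor (DerivedCategory X.left.Modules) ((q : ℤ) + 2)).map
      (DerivedCategory.Q.map φ)) hsuf
  simp only [Functor.map_comp] at hsufQ
  rw [hsufQ, reassoc_of% hT1]
  rfl

/-! ### Corollaries: on `E₀[0]` the complex-level `σ_q` / semiregularity predicates ARE the module-level ones -/

/-- In cohomology: `σ_q^C(E₀[0])(x.hom) = σ_q(E₀)(x) ∈ H^{q+2}(X, Ω^q)` (t-7's `sigmaCoh` against the tree's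
`sigmaHigher`). [cite: BuchweitzFlenner2003, Def. 4.1] -/
theorem sigmaCoh_single (q : ℕ) (x : Abelian.Ext E₀ E₀ 2) :
    sigmaCoh X (single₀ X.left E₀) 0 0 hK q x.hom = sigmaHigher hE₀ q x := by
  rw [sigmaCoh, sigmaExt_single X E₀ hE₀ hK q x, sigmaHigher_apply, traceCoeffToCohomology, AddMonoidHom.comp_apply]

/-- **`I`-semiregularity of the single complex `E₀[0]` (t-7's `IsISemiregularC`) is `I`-semiregularity of the
module `E₀` (the tree's `IsISemiregular`)** — `x ↦ x.hom` is Mathlib's bijection `Ext.homEquiv`, `σ_q^C ∘ (·.hom) = σ_q`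
by `sigmaCoh_single`, and `Ext(𝒪_X, –) → H(X, –)` is bijective (`extToCohomology_bijective`, Hartshorne III.6.3 (c)).
[cite: BuchweitzFlenner2003, §5 (I-semiregular)] -/
theorem isISemiregularC_single₀_iff (I : Set ℕ) :
    IsISemiregularC X (single₀ X.left E₀) 0 0 hK I ↔ IsISemiregular hE₀ I := by
  have hzero : ∀ (q : ℕ) (x : Abelian.Ext E₀ E₀ 2),
      sigmaHigher hE₀ q x = 0 ↔ sigmaC X (single₀ X.left E₀) 0 0 hK q x.hom = 0 := fun q x => by
    rw [← sigmaCoh_single X E₀ hE₀ hK q x, sigmaCoh]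
    constructor
    · intro h0
      have h1 : sigmaExt X (single₀ X.left E₀) 0 0 hK q x.hom = 0 :=
        (extToCohomology_bijective (hodgeSheaf X q) (q + 2)).1
          (h0.trans (map_zero (extToCohomology (hodgeSheaf X q) (q + 2))).symm)
      rw [sigmaExt, Equiv.symm_apply_eq] at h1
      exact h1.trans (Abelian.Ext.zero_hom _ _ _)
    · intro h0
      have h1 : sigmaExt X (single₀ X.left E₀) 0 0 hK q x.hom = 0 := by
        rw [sigmaExt, Equiv.symm_apply_eq, h0]
        exact (Abelian.Ext.zero_hom _ _ _).symm
      rw [h1, map_zero]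
      rfl
  rw [isISemiregularC_iff_ker, IsISemiregular]
  constructor
  · intro h x hx
    exact Abelian.Ext.homEquiv.injective
      ((h x.hom fun q hq => (hzero q x).1 (hx q hq)).trans (Abelian.Ext.zero_hom _ _ _).symm)
  · intro h y hy
    have hy' : Abelian.Ext.homEquiv.symm y = 0 := h _ fun q hq => (hzero q _).2 (by
      change sigmaC X (single₀ X.left E₀) 0 0 hK q (Abelian.Ext.homEquiv (Abelian.Ext.homEquiv.symm y)) = 0
      rw [Equiv.apply_symm_apply]
      exact hy q hq)
    rw [Equiv.symm_apply_eq] at hy'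
    exact hy'.trans (Abelian.Ext.zero_hom _ _ _)

/-- **`q`-semiregularity of `E₀[0]` is `q`-semiregularity of `E₀`** (`IsSemiregularC` against the tree's
`IsHigherSemiregular`). [cite: BuchweitzFlenner2003, §1 (k-semiregular)] -/
theorem isSemiregularC_single₀_iff (q : ℕ) :
    IsSemiregularC X (single₀ X.left E₀) 0 0 hK q ↔ IsHigherSemiregular hE₀ q := by
  rw [isSemiregularC_iff_isISemiregularC_singleton, isHigherSemiregular_iff_isISemiregular_singleton,
    isISemiregularC_single₀_iff]

end SigmaSingle

end HomComplex

end Literature.AlgebraicGeometry.HodgeTheory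

end
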